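import Literature.MathematicalPhysics.QuantumFieldTheory.MullerSchiemann1987.MS87Theorem3Extensions
import HarnessLib

/-!
# Müller–Schiemann, *Continuum limit of a hierarchical SU(2) lattice gauge theory in 4 dimensions*
# (CMP 110, 1987), THE LAST PARAGRAPH OF THE PROOF OF THEOREM 3 (p.283 L.40–45) FOR THE GAUGE-MODEL
# RECURSION (3.8), `r = 4`: the analytically continued (3.8) on the wider strip `|Im z| < 4d`, the one-step
# widening on `SU(2)` for `𝒯₄`, the widening tower with a general ratio, and THEOREM 3 on `SU(2)` with (A₁)'s
# «entire holomorphic in z» for `r = 4` (theorems only; no definition, no named fact)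

statement-level skeleton of published theorems with citation tags; proofs where landed; nothing here is a claim about the Yang–Mills mass gap

**Citation header (reproduction of PUBLISHED work).** V. F. Müller, J. Schiemann, *Continuum limit of a hierarchical
SU(2) lattice gauge theory in 4 dimensions*, Commun. Math. Phys. **110** (1987) 261–286, doi 10.1007/BF01207367
[MullerSchiemann1987]; (1.1) p.262, (3.8) p.267, p.268 L.1 and (3.9)–(3.11), Theorem 3 p.282 and the last paragraph of
its proof p.283 L.40–45, (A₁) p.266 (held Project Euclid scan `paper:url-96df5da18d4c`; displays read by this seat on
its own 3× page renders `run/shared/lean/pub/lit-balaban/lit-balaban-p12/renders-cmp110ms/ms87-cmp110-pdfp002,007,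
008,022,023-journalp262,267,268,282,283-x3.png`). Lean lane of the lit-balaban YM LIT SWEEP CONTEXT row X1 (register
level; zero weight for any token of that table); the model is the `d = 4` HIERARCHICAL `SU(2)` gauge model, NOT lattice
Yang–Mills.

**What the paper prints.** p.267 L.33 – p.268 L.1: *«Theorem 1 is a consequence of the recursion relation (3.1),
which corresponds physically to a two-dimensional chiral spin system. In the case of a lattice gauge model in 4
dimensions with smallest block length (l = 2) we have to deal instead of (3.1) with the recursion relation – see (2.1),
(2.10 M) of (I) with q = r = 4 –
g̃′(u, z) = (1/𝒩){∫ dv₁ dv₂ dv₃ g̃(uv₁⁻¹, z/4) g̃(v₁v₂⁻¹, z/4) g̃(v₂v₃⁻¹, z/4) g̃(v₃, z/4)}⁴. (3.8)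
We can reduce its analysis to the preceding one.»*; (1.1) p.262: *«(𝒯g)(u) = {g^{*r}(u)/g^{*r}(e₀)}^r … hence the
minimal value for r is 4 {2}»*; Theorem 3 p.282: *«… extensions g̃^{(−n)}(u, z), (2.7), satisfying (A₁) … due to the
property 𝒯g^{(−n)}(u) = g^{(−n+1)}(u)»*; proof of Theorem 3, p.283 L.40–45: *«Finally the analytically extended version
of 𝒯, (3.1), (3.8), when applied to g̃^{(−n−1)}(u, z) as given by (6.21), yields an analytic continuation of
g̃^{(−n)}(u, z) to the wider strip z ∈ ℂ, |Im z| < r·(κ/2)(β^{(−n−1)})^{−α}. Iterating this argument, with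
r^m(β^{(−n−m)})^{−α} → ∞ (m → ∞), shows that g̃^{(−n)}(u, z) is entire in z ∈ ℂ for all n. □»*; (A₁) p.266: *«g̃(u, z)
is continuous in u ∈ G for fixed z ∈ ℂ and entire holomorphic in z for fixed u.»*

**Why this file.** The siblings `MS87MigdalStripWidening` ((3.1) on the wider strip `|Im z| < 2d`) and
`MS87Theorem3Extensions` (`widening_step`, `entire_of_tower`, `theorem3_SU2_entire`) wrote out ONLY the case `r = 2`
((3.1)) of the last paragraph and declared (3.8) «the same argument, not repeated». The paper names BOTH «(3.1), (3.8)»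
there, with the strip widened by the factor `r` and «r^m(β^{(−n−m)})^{−α} → ∞»; the gauge model of the title is the
case `r = 4`. This file writes that case out.

**What this file proves (kernel-checked, 0 sorry, standard axioms; no definition, no named fact).** `𝒢`, `𝒯_r`,
`g^{*4}` are the sibling `MS87MigdalRecursion`'s `Migdal.InG`, `Migdal.migdal r`, `Migdal.convPow g 3`; `u₀, u₃,
e^{−ixσ₃}` are `HeatKernel.u0/u3/diagPhase`; the ellipse `𝒟(d)` and the strips `{|Im z| < d}` are written out; the
Haar probability measure is the tree's `haarProbability`.
* §1 strip geometry for the arguments `z/4` of (3.8) (`abs_im_quarter_lt`).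
* §2 the two-factor continued convolution `(u, ζ) ↦ ∫dv A(uv⁻¹, ζ) B(v, ζ)` of two families jointly continuous on
  `G × {|Im ζ| < e}` and holomorphic in `ζ`: it is again holomorphic in `ζ` (`differentiableOn_conv`, dominated
  parameter integrals, the tree's `Literature.Analysis.Complex.differentiableOn_integral_of_dominated`; the majorant is a
  constant from compactness of `G × closed ball`, `exists_bound_closedBall`) and jointly continuous (`continuousOn_conv`,
  dominated convergence; `G` first countable) — any compact group `G`.
* §3 **(3.8) ANALYTICALLY CONTINUED ON THE WIDER STRIP**: for `g̃` jointly continuous on `G × {|Im z| < e}` and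
  holomorphic in `z` there, the brace of (3.8) — the triple Haar integral, written as the iterated integral
  `∫dv₁ g̃(uv₁⁻¹, z/4) ∫dv₂ g̃(v₁v₂⁻¹, z/4) ∫dv₃ g̃(v₂v₃⁻¹, z/4) g̃(v₃, z/4)` exactly as in the sibling's real-slice
  identity `Migdal.eq38_real` — is HOLOMORPHIC on `{|Im z| < 4e}` for every `u` (`differentiableOn_brace38`: §2 three
  times, then `z ↦ z/4`) and jointly continuous on `G × {|Im z| < 4e}` (`continuousOn_brace38`); hence so is
  `g̃′(u, z) = (brace/𝒩′)⁴` for any constant `𝒩′` (`differentiableOn_eq38`, `continuousOn_eq38`).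
* §4 on `G = SU(2)`: `(e^{−(i/4)tσ₃})⁴ = e^{−itσ₃}` (`diagPhase_quarter_pow_four`) and **the real slice of the
  continued (3.8)**: for `g = H(u₀)` a class function and real `t`, the brace of (3.8) for `g̃_H(w, ζ) = H(u₀(w) cos ζ +
  u₃(w) sin ζ)` ((6.21)) at `z = t` equals `g^{*4}(e^{−itσ₃}u)` (`brace38_real_slice`: (2.6) `eq621_real_slice` on every
  factor and `Migdal.eq38_real`).
* §5 **THE ONE-STEP WIDENING FOR `𝒯₄`** (p.283 L.40–43 with (3.8)): with `g = H(u₀)`, `g′ = H′(u₀)` a class function and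
  `𝒯₄ g′ = g`, the extension `H(u₀ cos z + u₃ sin z)` ((6.21) at scale `−n`) and the continued (3.8) applied to
  `g̃_{H′}` (scale `−n−1`) with `𝒩′ = g′^{*4}(e₀)` AGREE on `{|Im z| < min(d, 4d′)}` (`widening_step4`: both holomorphic,
  equal for real `z` by §4 and (1.1) `Migdal.migdal_four`; identity theorem on the strip, the tree's
  `eqOn_setOf_abs_im_lt_of_forall_ofReal`); hence the continuation to the wider strip `{|Im z| < 4d′}` when `d ≤ 4d′`
  (`widening_step4_exists`) — «|Im z| < r·(κ/2)(β^{(−n−1)})^{−α}» with `r = 4`.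
* §6 **the widening tower with a general ratio `ρ`** (`entire_of_tower_ratio`): the sibling's `entire_of_tower` had the
  ratio `2` built in; here scale-indexed transforms `T n` multiply the strip of holomorphy by `ρ`, `T n (A (n+1)) = A n`
  on the strip of `A n`, `d_n ≤ ρ d_{n+1}` and `ρ^m d_{n+m} → ∞` («r^m(β^{(−n−m)})^{−α} → ∞») ⟹ every `A n (x, ·)` is
  the restriction of an ENTIRE function (same gluing proof; `ρ = 2` is the sibling's statement, `ρ = 4` is used here).
* §7 **«… shows that g̃^{(−n)}(u, z) is entire in z ∈ ℂ for all n. □» for `r = 4`** (`entire_of_limits4`) and the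
  assembled **`theorem3_SU2_entire4`**: the conclusions of the sibling `theorem3_SU2` with `r = 4` AND, for every `n`,
  `u`, an ENTIRE `F` equal to `g̃^{(−n)}(u, ·)` on `{|Im z| < d_n}`, under `d_n ≤ 4d_{n+1}`, `4^m d_{n+m} → ∞`.

**Readings / scope (declared).** (i) As in the siblings, the common subsequence of Theorem 3 comes from the Cantor
diagonal and property (i); injectivity (ii) of `𝒯` is neither used nor claimed. (ii) The triple integral
`∫dv₁dv₂dv₃` of (3.8) is rendered as the iterated integral (innermost `dv₃`), the form of the sibling's `eq38_real`; no
Fubini statement about the product-measure form is made or needed. (iii) The normalisation `𝒩` of (3.8) is rendered on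
the coarse scale as `𝒩′⁴` with `𝒩′ = g′^{*4}(e₀)` ((1.1): `𝒯g = {g^{*4}/g^{*4}(e₀)}⁴`); the reduction (3.9)–(3.11)
`𝒯₍₄₎ = {𝒯₍₂₎[𝒯₍₂₎·]^{1/2}}²` of p.268 is not used and not formalized here. (iv) The growth hypotheses `d_n ≤ 4d_{n+1}`,
`4^m d_{n+m} → ∞` render «the wider strip» and «r^m(β^{(−n−m)})^{−α} → ∞» for `r = 4`; in the paper
`d_n = (κ/2)(β^{(−n)})^{−α}` with `β^{(−n)} = B_n + 𝒪(1)` (6.17), so both hold there; they are hypotheses here.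
(v) «Entire» is rendered as in the sibling: the strip-defined extension is the restriction of an entire function.

**Not claimed.** Property (ii); Theorems 1, 2, 4; the Corollary (3.15); (3.9)–(3.11); anything about lattice
Yang–Mills or the Clay problem.
-/

noncomputable section

open Filter Set Metric Function Complex MeasureTheory
open scoped Topology Real

namespace Literature.MathematicalPhysics.QuantumFieldTheory

namespace MullerSchiemann1987

namespace Theorem3ExtensionsR4

open Literature.Analysis.Complex (differentiableOn_integral_of_dominated isOpen_setOf_abs_im_lt
  eqOn_setOf_abs_im_lt_of_forall_ofReal)
open HeatKernel (u0 u3 diagPhase diagPhase_add)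
open Migdal (InG migdal IsCentral convPow eq38_real migdal_four)
open MigdalStripWidening (continuous_section abs_im_lt_of_mem_ball abs_im_le_of_mem_closedBall
  differentiable_of_strips)
open Theorem3Continuation (differentiableOn_eq621 continuousOn_eq621)
open Theorem3Extensions (theorem3_SU2 eq621_real_slice)

/-! ## §1 Strip geometry for the arguments `z/4` of (3.8) -/

/-- `|Im z| < 4d ⟹ |Im(z/4)| < d`: quartering the argument, as in (3.8), maps the wider strip into the strip.
[cite: MullerSchiemann1987, (3.8) p.267, p.283 L.40–43] -/
theorem abs_im_quarter_lt {d : ℝ} {z : ℂ} (hz : |z.im| < 4 * d) : |(z / 4).im| < d := by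
  rw [Complex.div_ofNat_im, abs_div, Nat.abs_ofNat, div_lt_iff₀ (by norm_num : (0 : ℝ) < 4)]
  linarith

section CompactGroup

variable {G : Type*} [Group G] [TopologicalSpace G] [IsTopologicalGroup G] [CompactSpace G]
  [MeasurableSpace G] [BorelSpace G]

/-! ## §2 The two-factor continued convolution `(u, ζ) ↦ ∫dv A(uv⁻¹, ζ) B(v, ζ)` on `G × {|Im ζ| < e}` -/

omit [Group G] [IsTopologicalGroup G] [MeasurableSpace G] [BorelSpace G] in
/-- A uniform bound for a jointly continuous family on `G × (closed ball)` inside `G × strip` (compactness + joint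
continuity), in the form used for the local majorant: for `|Im z₀| < e` there is `C` with `‖A(w, z)‖ ≤ C` for all
`w ∈ G`, `‖z − z₀‖ < (e − |Im z₀|)/2`. [cite: MullerSchiemann1987, (3.8) p.267, p.283 L.40–43] -/
theorem exists_bound_closedBall {e : ℝ} {A : G → ℂ → ℂ}
    (hA : ContinuousOn (uncurry A) (univ ×ˢ {z : ℂ | |z.im| < e})) {z₀ : ℂ} (hz₀ : |z₀.im| < e) :
    ∃ C : ℝ, 0 ≤ C ∧ ∀ (w : G) (z : ℂ), z ∈ ball z₀ ((e - |z₀.im|) / 2) → ‖A w z‖ ≤ C := by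
  set R : ℝ := (e - |z₀.im|) / 2 with hR
  set K : Set (G × ℂ) := univ ×ˢ closedBall z₀ R with hK
  have hKc : IsCompact K := isCompact_univ.prod (isCompact_closedBall _ _)
  have hKsub : K ⊆ univ ×ˢ {z : ℂ | |z.im| < e} := by
    rintro ⟨w, ζ⟩ ⟨-, hζ⟩
    refine ⟨mem_univ _, ?_⟩
    show |ζ.im| < e
    have h1 := abs_im_le_of_mem_closedBall hζ
    rw [hR] at h1
    linarith
  obtain ⟨C, hC⟩ := hKc.exists_bound_of_continuousOn (hA.mono hKsub)
  refine ⟨max C 0, le_max_right _ _, fun w z hz => ?_⟩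
  have hmem : (w, z) ∈ K := ⟨mem_univ _, ball_subset_closedBall hz⟩
  exact (hC (w, z) hmem).trans (le_max_left _ _)

/-- **The continued convolution is holomorphic**: if `A`, `B` are jointly continuous on `G × {|Im ζ| < e}` and
holomorphic in `ζ` there for every group element, then for every `u ∈ G` the parameter integral
`ζ ↦ ∫dv A(uv⁻¹, ζ) B(v, ζ)` is holomorphic on `{|Im ζ| < e}` (holomorphy of dominated parameter integrals; the
majorant is a constant from compactness of `G`). This is the analytic mechanism behind «the analytically extended
version of 𝒯 … (3.8)». [cite: MullerSchiemann1987, (3.8) p.267, Thm 3 proof p.283 L.40–43] -/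
theorem differentiableOn_conv {e : ℝ} {A B : G → ℂ → ℂ}
    (hA : ContinuousOn (uncurry A) (univ ×ˢ {z : ℂ | |z.im| < e}))
    (hB : ContinuousOn (uncurry B) (univ ×ˢ {z : ℂ | |z.im| < e}))
    (hAh : ∀ w : G, DifferentiableOn ℂ (A w) {z : ℂ | |z.im| < e})
    (hBh : ∀ w : G, DifferentiableOn ℂ (B w) {z : ℂ | |z.im| < e}) (u : G) :
    DifferentiableOn ℂ (fun z : ℂ => ∫ v, A (u * v⁻¹) z * B v z ∂(haarProbability G))
      {z : ℂ | |z.im| < e} := by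
  refine differentiableOn_integral_of_dominated (fun z hz => ?_) (Eventually.of_forall fun v => ?_)
    fun z₀ hz₀ => ?_
  · -- measurability of the sections
    exact ((continuous_section hA hz (continuous_const.mul continuous_inv)).mul
      (continuous_section hB hz continuous_id)).aestronglyMeasurable
  · -- holomorphy in `z` for fixed `v`
    exact (hAh (u * v⁻¹)).mul (hBh v)
  · -- local constant majorant
    have hz₀' : |z₀.im| < e := hz₀
    obtain ⟨C₁, hC₁0, hC₁⟩ := exists_bound_closedBall hA hz₀'
    obtain ⟨C₂, hC₂0, hC₂⟩ := exists_bound_closedBall hB hz₀'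
    refine ⟨(e - |z₀.im|) / 2, by linarith, fun z hz => ?_, fun _ => C₁ * C₂, integrable_const _,
      Eventually.of_forall fun v z hz => ?_⟩
    · show |z.im| < e
      have := abs_im_lt_of_mem_ball hz
      linarith
    · rw [norm_mul]
      exact mul_le_mul (hC₁ _ z hz) (hC₂ _ z hz) (norm_nonneg _) hC₁0

/-- **The continued convolution is jointly continuous** on `G × {|Im ζ| < e}` («clearly continuous in u ∈ G» one
scale up), by dominated convergence with the constant majorant. [cite: MullerSchiemann1987, (3.8) p.267, (6.21)
p.283, Thm 3 proof p.283 L.40–43] -/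
theorem continuousOn_conv [FirstCountableTopology G] {e : ℝ} {A B : G → ℂ → ℂ}
    (hA : ContinuousOn (uncurry A) (univ ×ˢ {z : ℂ | |z.im| < e}))
    (hB : ContinuousOn (uncurry B) (univ ×ˢ {z : ℂ | |z.im| < e})) :
    ContinuousOn (uncurry fun (u : G) (z : ℂ) => ∫ v, A (u * v⁻¹) z * B v z ∂(haarProbability G))
      (univ ×ˢ {z : ℂ | |z.im| < e}) := by
  rintro ⟨u₀, z₀⟩ ⟨-, hz₀⟩
  have hz₀' : |z₀.im| < e := hz₀
  have hS : IsOpen {z : ℂ | |z.im| < e} := isOpen_setOf_abs_im_lt e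
  apply ContinuousAt.continuousWithinAt
  show ContinuousAt (fun p : G × ℂ => ∫ v, A (p.1 * v⁻¹) p.2 * B v p.2 ∂(haarProbability G)) (u₀, z₀)
  set R : ℝ := (e - |z₀.im|) / 2 with hR
  have hR0 : 0 < R := by rw [hR]; linarith
  have hN : univ ×ˢ ball z₀ R ∈ 𝓝 (u₀, z₀) := prod_mem_nhds Filter.univ_mem (ball_mem_nhds z₀ hR0)
  have hball : ∀ z ∈ ball z₀ R, |z.im| < e := fun z hz => by
    have := abs_im_lt_of_mem_ball hz
    rw [hR] at this
    linarith
  obtain ⟨C₁, hC₁0, hC₁⟩ := exists_bound_closedBall hA hz₀'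
  obtain ⟨C₂, hC₂0, hC₂⟩ := exists_bound_closedBall hB hz₀'
  refine continuousAt_of_dominated ?_ ?_ (integrable_const (C₁ * C₂)) ?_
  · filter_upwards [hN] with p hp
    exact ((continuous_section hA (hball p.2 hp.2) (continuous_const.mul continuous_inv)).mul
      (continuous_section hB (hball p.2 hp.2) continuous_id)).aestronglyMeasurable
  · filter_upwards [hN] with p hp
    refine Eventually.of_forall fun v => ?_
    rw [norm_mul]
    exact mul_le_mul (hC₁ _ p.2 hp.2) (hC₂ _ p.2 hp.2) (norm_nonneg _) hC₁0
  · refine Eventually.of_forall fun v => ?_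
    have hAat : ContinuousAt (uncurry A) (u₀ * v⁻¹, z₀) :=
      hA.continuousAt ((isOpen_univ.prod hS).mem_nhds ⟨mem_univ _, hz₀'⟩)
    have hBat : ContinuousAt (uncurry B) (v, z₀) :=
      hB.continuousAt ((isOpen_univ.prod hS).mem_nhds ⟨mem_univ _, hz₀'⟩)
    have hφ : Continuous fun p : G × ℂ => (p.1 * v⁻¹, p.2) :=
      (continuous_fst.mul continuous_const).prodMk continuous_snd
    have hψ : Continuous fun p : G × ℂ => (v, p.2) := continuous_const.prodMk continuous_snd
    exact (hAat.comp_of_eq hφ.continuousAt rfl).mul (hBat.comp_of_eq hψ.continuousAt rfl)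

/-! ## §3 (3.8) analytically continued: the iterated triple Haar integral with arguments `z/4` on the WIDER strip
`{|Im z| < 4e}` -/

/-- **«an analytic continuation … to the wider strip» for (3.8)**: if `g̃` is jointly continuous on `G × {|Im z| < e}`
and holomorphic in `z` there, then for every `u ∈ G` the brace of (3.8),
`z ↦ ∫dv₁ g̃(uv₁⁻¹, z/4) ∫dv₂ g̃(v₁v₂⁻¹, z/4) ∫dv₃ g̃(v₂v₃⁻¹, z/4) g̃(v₃, z/4)`, is HOLOMORPHIC on the wider strip
`{|Im z| < 4e}` (§2 applied three times on `{|Im ζ| < e}`, then `ζ = z/4`).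
[cite: MullerSchiemann1987, (3.8) p.267, Thm 3 proof p.283 L.40–43] -/
theorem differentiableOn_brace38 [FirstCountableTopology G] {e : ℝ} {B : G → ℂ → ℂ}
    (hBc : ContinuousOn (uncurry B) (univ ×ˢ {z : ℂ | |z.im| < e}))
    (hBh : ∀ w : G, DifferentiableOn ℂ (B w) {z : ℂ | |z.im| < e}) (u : G) :
    DifferentiableOn ℂ (fun z : ℂ => ∫ v₁, B (u * v₁⁻¹) (z / 4) * ∫ v₂, B (v₁ * v₂⁻¹) (z / 4) *
        ∫ v₃, B (v₂ * v₃⁻¹) (z / 4) * B v₃ (z / 4) ∂(haarProbability G) ∂(haarProbability G)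
        ∂(haarProbability G)) {z : ℂ | |z.im| < 4 * e} := by
  -- innermost: `(w, ζ) ↦ ∫dv₃ g̃(wv₃⁻¹, ζ) g̃(v₃, ζ)`
  have h3c : ContinuousOn (uncurry fun (w : G) (ζ : ℂ) => ∫ v₃, B (w * v₃⁻¹) ζ * B v₃ ζ ∂(haarProbability G))
      (univ ×ˢ {z : ℂ | |z.im| < e}) := continuousOn_conv hBc hBc
  have h3h : ∀ w : G, DifferentiableOn ℂ (fun ζ : ℂ => ∫ v₃, B (w * v₃⁻¹) ζ * B v₃ ζ ∂(haarProbability G))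
      {z : ℂ | |z.im| < e} := differentiableOn_conv hBc hBc hBh hBh
  -- middle: `(w, ζ) ↦ ∫dv₂ g̃(wv₂⁻¹, ζ) [inner](v₂, ζ)`
  have h2c : ContinuousOn (uncurry fun (w : G) (ζ : ℂ) => ∫ v₂, B (w * v₂⁻¹) ζ *
      ∫ v₃, B (v₂ * v₃⁻¹) ζ * B v₃ ζ ∂(haarProbability G) ∂(haarProbability G))
      (univ ×ˢ {z : ℂ | |z.im| < e}) := continuousOn_conv hBc h3c
  have h2h : ∀ w : G, DifferentiableOn ℂ (fun ζ : ℂ => ∫ v₂, B (w * v₂⁻¹) ζ *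
      ∫ v₃, B (v₂ * v₃⁻¹) ζ * B v₃ ζ ∂(haarProbability G) ∂(haarProbability G))
      {z : ℂ | |z.im| < e} := differentiableOn_conv hBc h3c hBh h3h
  -- outermost: `(u, ζ) ↦ ∫dv₁ g̃(uv₁⁻¹, ζ) [middle](v₁, ζ)`
  have h1h : ∀ w : G, DifferentiableOn ℂ (fun ζ : ℂ => ∫ v₁, B (w * v₁⁻¹) ζ * ∫ v₂, B (v₁ * v₂⁻¹) ζ *
      ∫ v₃, B (v₂ * v₃⁻¹) ζ * B v₃ ζ ∂(haarProbability G) ∂(haarProbability G) ∂(haarProbability G))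
      {z : ℂ | |z.im| < e} := differentiableOn_conv hBc h2c hBh h2h
  -- the arguments `z/4`
  have hmaps : MapsTo (fun z : ℂ => z / 4) {z : ℂ | |z.im| < 4 * e} {z : ℂ | |z.im| < e} :=
    fun z hz => abs_im_quarter_lt hz
  have hdiv : DifferentiableOn ℂ (fun z : ℂ => z / 4) {z : ℂ | |z.im| < 4 * e} :=
    (differentiable_id.div_const (4 : ℂ)).differentiableOn
  exact (h1h u).comp hdiv hmaps

/-- **«clearly continuous in u ∈ G» one scale up, for (3.8)**: under joint continuity of `g̃` on `G × {|Im z| < e}`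
the brace of (3.8) is jointly continuous on `G × {|Im z| < 4e}`. [cite: MullerSchiemann1987, (3.8) p.267, (6.21)
p.283, Thm 3 proof p.283 L.40–43] -/
theorem continuousOn_brace38 [FirstCountableTopology G] {e : ℝ} {B : G → ℂ → ℂ}
    (hBc : ContinuousOn (uncurry B) (univ ×ˢ {z : ℂ | |z.im| < e})) :
    ContinuousOn (uncurry fun (u : G) (z : ℂ) => ∫ v₁, B (u * v₁⁻¹) (z / 4) * ∫ v₂, B (v₁ * v₂⁻¹) (z / 4) *
        ∫ v₃, B (v₂ * v₃⁻¹) (z / 4) * B v₃ (z / 4) ∂(haarProbability G) ∂(haarProbability G)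
        ∂(haarProbability G)) (univ ×ˢ {z : ℂ | |z.im| < 4 * e}) := by
  have h3c : ContinuousOn (uncurry fun (w : G) (ζ : ℂ) => ∫ v₃, B (w * v₃⁻¹) ζ * B v₃ ζ ∂(haarProbability G))
      (univ ×ˢ {z : ℂ | |z.im| < e}) := continuousOn_conv hBc hBc
  have h2c : ContinuousOn (uncurry fun (w : G) (ζ : ℂ) => ∫ v₂, B (w * v₂⁻¹) ζ *
      ∫ v₃, B (v₂ * v₃⁻¹) ζ * B v₃ ζ ∂(haarProbability G) ∂(haarProbability G))
      (univ ×ˢ {z : ℂ | |z.im| < e}) := continuousOn_conv hBc h3c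
  have h1c : ContinuousOn (uncurry fun (w : G) (ζ : ℂ) => ∫ v₁, B (w * v₁⁻¹) ζ * ∫ v₂, B (v₁ * v₂⁻¹) ζ *
      ∫ v₃, B (v₂ * v₃⁻¹) ζ * B v₃ ζ ∂(haarProbability G) ∂(haarProbability G) ∂(haarProbability G))
      (univ ×ˢ {z : ℂ | |z.im| < e}) := continuousOn_conv hBc h2c
  have hmaps : MapsTo (fun p : G × ℂ => (p.1, p.2 / 4)) (univ ×ˢ {z : ℂ | |z.im| < 4 * e})
      (univ ×ˢ {z : ℂ | |z.im| < e}) := fun p hp => ⟨mem_univ _, abs_im_quarter_lt hp.2⟩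
  have hq : Continuous fun p : G × ℂ => (p.1, p.2 / 4) := continuous_fst.prodMk (continuous_snd.div_const _)
  exact h1c.comp hq.continuousOn hmaps

/-- **(3.8) on the wider strip**: `g̃′(u, z) = (brace/𝒩′)⁴` is holomorphic on `{|Im z| < 4e}` for every `u` (any
constant `𝒩′`; the paper's `1/𝒩` with `𝒩 = 𝒩′⁴`, `𝒩′ = g^{*4}(e₀)` by (1.1)). [cite: MullerSchiemann1987, (3.8) p.267,
(1.1) p.262, Thm 3 proof p.283 L.40–43] -/
theorem differentiableOn_eq38 [FirstCountableTopology G] {e : ℝ} {B : G → ℂ → ℂ}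
    (hBc : ContinuousOn (uncurry B) (univ ×ˢ {z : ℂ | |z.im| < e}))
    (hBh : ∀ w : G, DifferentiableOn ℂ (B w) {z : ℂ | |z.im| < e}) (N : ℂ) (u : G) :
    DifferentiableOn ℂ (fun z : ℂ => ((∫ v₁, B (u * v₁⁻¹) (z / 4) * ∫ v₂, B (v₁ * v₂⁻¹) (z / 4) *
        ∫ v₃, B (v₂ * v₃⁻¹) (z / 4) * B v₃ (z / 4) ∂(haarProbability G) ∂(haarProbability G)
        ∂(haarProbability G)) / N) ^ 4) {z : ℂ | |z.im| < 4 * e} :=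
  ((differentiableOn_brace38 hBc hBh u).div_const N).pow 4

/-- (3.8) on the wider strip is jointly continuous on `G × {|Im z| < 4e}`. [cite: MullerSchiemann1987, (3.8) p.267,
Thm 3 proof p.283 L.40–43] -/
theorem continuousOn_eq38 [FirstCountableTopology G] {e : ℝ} {B : G → ℂ → ℂ}
    (hBc : ContinuousOn (uncurry B) (univ ×ˢ {z : ℂ | |z.im| < e})) (N : ℂ) :
    ContinuousOn (uncurry fun (u : G) (z : ℂ) => ((∫ v₁, B (u * v₁⁻¹) (z / 4) * ∫ v₂, B (v₁ * v₂⁻¹) (z / 4) *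
        ∫ v₃, B (v₂ * v₃⁻¹) (z / 4) * B v₃ (z / 4) ∂(haarProbability G) ∂(haarProbability G)
        ∂(haarProbability G)) / N) ^ 4) (univ ×ˢ {z : ℂ | |z.im| < 4 * e}) :=
  ((continuousOn_brace38 hBc).div_const N).pow 4

end CompactGroup

/-! ## §4 `G = SU(2)`: `(e^{−(i/4)tσ₃})⁴ = e^{−itσ₃}` and the real slice of the continued (3.8) -/

/-- `(e^{−(i/4)tσ₃})⁴ = e^{−itσ₃}`: the group element `a` of the sibling's `eq38_real` (`g̃(w, t/4) = g(aw)`,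
`a⁴u = e^{−itσ₃}u`). [cite: MullerSchiemann1987, (3.8) p.267, (2.6) p.264] -/
theorem diagPhase_quarter_pow_four (t : ℝ) : diagPhase (t / 4) ^ 4 = diagPhase t := by
  rw [show diagPhase t = diagPhase (t / 4 + t / 4 + t / 4 + t / 4) by ring_nf, diagPhase_add, diagPhase_add,
    diagPhase_add]
  simp only [pow_succ, pow_zero, one_mul]

/-- **The real slice of the continued (3.8)**: for a class function `g = H(u₀)` on `SU(2)` and real `t`, the brace of
(3.8) for the extension `g̃_H(w, ζ) = H(u₀(w) cos ζ + u₃(w) sin ζ)` ((6.21)) at `z = t` is `g^{*4}(e^{−itσ₃}u)` — every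
factor is `g̃_H(w, t/4) = g(e^{−(i/4)tσ₃}w)` by (2.6), and the iterated integral is `g^{*4}((e^{−(i/4)tσ₃})⁴u)` by the
sibling's `Migdal.eq38_real`. [cite: MullerSchiemann1987, (3.8) p.267, (2.6) p.264, (6.21) p.283] -/
theorem brace38_real_slice {H : ℂ → ℂ} {g : (Matrix.specialUnitaryGroup (Fin 2) ℂ) → ℝ}
    (hg : ∀ U, (g U : ℂ) = H (u0 U)) (hc : IsCentral g) (U : (Matrix.specialUnitaryGroup (Fin 2) ℂ)) (t : ℝ) :
    (∫ V₁, H ((u0 (U * V₁⁻¹) : ℂ) * Complex.cos ((t : ℂ) / 4) + (u3 (U * V₁⁻¹) : ℂ) * Complex.sin ((t : ℂ) / 4)) *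
      ∫ V₂, H ((u0 (V₁ * V₂⁻¹) : ℂ) * Complex.cos ((t : ℂ) / 4) + (u3 (V₁ * V₂⁻¹) : ℂ) * Complex.sin ((t : ℂ) / 4)) *
        ∫ V₃, H ((u0 (V₂ * V₃⁻¹) : ℂ) * Complex.cos ((t : ℂ) / 4) + (u3 (V₂ * V₃⁻¹) : ℂ) * Complex.sin ((t : ℂ) / 4)) *
          H ((u0 V₃ : ℂ) * Complex.cos ((t : ℂ) / 4) + (u3 V₃ : ℂ) * Complex.sin ((t : ℂ) / 4))
        ∂(haarProbability (Matrix.specialUnitaryGroup (Fin 2) ℂ)) ∂(haarProbability (Matrix.specialUnitaryGroup (Fin 2) ℂ))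
      ∂(haarProbability (Matrix.specialUnitaryGroup (Fin 2) ℂ))) =
      ((convPow g 3 (diagPhase t * U) : ℝ) : ℂ) := by
  have e4 : (t : ℂ) / 4 = ((t / 4 : ℝ) : ℂ) := by push_cast; ring
  simp only [e4, eq621_real_slice hg]
  rw [← diagPhase_quarter_pow_four t, eq38_real hc (diagPhase (t / 4)) U]
  simp only [mul_assoc, ← integral_complex_ofReal, Complex.ofReal_mul]

/-! ## §5 The one-step widening on `SU(2)` for `𝒯₄` (p.283 L.40–43 with (3.8)): the continued (3.8) applied to
`g̃^{(−n−1)}` reproduces `g̃^{(−n)}` on its strip — identity theorem from the REAL identity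
`g̃^{(−n)}(u, t) = g^{(−n)}(e^{−itσ₃}u) = 𝒯₄ g^{(−n−1)}(e^{−itσ₃}u) = {g^{(−n−1)*4}(e^{−itσ₃}u)/g^{(−n−1)*4}(e₀)}⁴` -/

/-- **One widening step, `r = 4`**: with `g = H(u₀)`, `g′ = H′(u₀)` a class function, `𝒯₄ g′ = g`, the extension
`g̃_H(u, z) = H(u₀ cos z + u₃ sin z)` ((6.21) at scale `−n`) and the continued recursion (3.8) applied to `g̃_{H′}`
(scale `−n−1`), `z ↦ {∫dv₁ g̃_{H′}(uv₁⁻¹, z/4) ∫dv₂ g̃_{H′}(v₁v₂⁻¹, z/4) ∫dv₃ g̃_{H′}(v₂v₃⁻¹, z/4) g̃_{H′}(v₃, z/4)/𝒩′}⁴`,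
`𝒩′ = g′^{*4}(e₀)`, AGREE on the strip `{|Im z| < min(d, 4d′)}` — both are holomorphic there and they agree for real
`z = t` by (2.6), (3.8) at a real angle and (1.1). [cite: MullerSchiemann1987, Thm 3 proof p.283 L.40–43, (3.8) p.267,
(1.1) p.262] -/
theorem widening_step4 {d d' : ℝ} (hd : 0 < d) (hd' : 0 < d') {H H' : ℂ → ℂ}
    {g g' : (Matrix.specialUnitaryGroup (Fin 2) ℂ) → ℝ}
    (hH : DifferentiableOn ℂ H {w : ℂ | w.re ^ 2 / Real.cosh d ^ 2 + w.im ^ 2 / Real.sinh d ^ 2 < 1})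
    (hH' : DifferentiableOn ℂ H' {w : ℂ | w.re ^ 2 / Real.cosh d' ^ 2 + w.im ^ 2 / Real.sinh d' ^ 2 < 1})
    (hg : ∀ U, (g U : ℂ) = H (u0 U)) (hg' : ∀ U, (g' U : ℂ) = H' (u0 U)) (hc' : IsCentral g')
    (hT : migdal 4 g' = g) (U : (Matrix.specialUnitaryGroup (Fin 2) ℂ)) :
    EqOn (fun z : ℂ => H ((u0 U : ℂ) * Complex.cos z + (u3 U : ℂ) * Complex.sin z))
      (fun z : ℂ => ((∫ V₁, H' ((u0 (U * V₁⁻¹) : ℂ) * Complex.cos (z / 4) + (u3 (U * V₁⁻¹) : ℂ) * Complex.sin (z / 4)) *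
          ∫ V₂, H' ((u0 (V₁ * V₂⁻¹) : ℂ) * Complex.cos (z / 4) + (u3 (V₁ * V₂⁻¹) : ℂ) * Complex.sin (z / 4)) *
            ∫ V₃, H' ((u0 (V₂ * V₃⁻¹) : ℂ) * Complex.cos (z / 4) + (u3 (V₂ * V₃⁻¹) : ℂ) * Complex.sin (z / 4)) *
              H' ((u0 V₃ : ℂ) * Complex.cos (z / 4) + (u3 V₃ : ℂ) * Complex.sin (z / 4))
            ∂(haarProbability (Matrix.specialUnitaryGroup (Fin 2) ℂ))
            ∂(haarProbability (Matrix.specialUnitaryGroup (Fin 2) ℂ))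
          ∂(haarProbability (Matrix.specialUnitaryGroup (Fin 2) ℂ))) /
          ((convPow g' 3 1 : ℝ) : ℂ)) ^ 4)
      {z : ℂ | |z.im| < min d (4 * d')} := by
  -- `SU(2) ⊆ M₂(ℂ)` is first countable (dominated-convergence continuity of the continued convolutions)
  haveI : FirstCountableTopology (Matrix (Fin 2) (Fin 2) ℂ) :=
    inferInstanceAs (FirstCountableTopology (Fin 2 → Fin 2 → ℂ))
  haveI : FirstCountableTopology (Matrix.specialUnitaryGroup (Fin 2) ℂ) :=
    Topology.IsInducing.subtypeVal.firstCountableTopology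
  have hmin : 0 < min d (4 * d') := lt_min hd (by linarith)
  -- joint continuity of `g̃_{H′}` in the format of §3
  have hcont : ContinuousOn (uncurry fun (W : (Matrix.specialUnitaryGroup (Fin 2) ℂ)) (w : ℂ) =>
      H' ((u0 W : ℂ) * Complex.cos w + (u3 W : ℂ) * Complex.sin w)) (univ ×ˢ {z : ℂ | |z.im| < d'}) := by
    have := continuousOn_eq621 hH'.continuousOn
    rw [show (univ ×ˢ {z : ℂ | |z.im| < d'} : Set ((Matrix.specialUnitaryGroup (Fin 2) ℂ) × ℂ)) =
      {p | |p.2.im| < d'} by ext p; simp]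
    exact this
  refine eqOn_setOf_abs_im_lt_of_forall_ofReal hmin
    ((differentiableOn_eq621 hH U).mono fun z (hz : |z.im| < min d (4 * d')) =>
      show |z.im| < d from lt_of_lt_of_le hz (min_le_left _ _))
    ((differentiableOn_eq38 hcont (fun W => differentiableOn_eq621 hH' W) ((convPow g' 3 1 : ℝ) : ℂ) U).mono
      fun z (hz : |z.im| < min d (4 * d')) => show |z.im| < 4 * d' from lt_of_lt_of_le hz (min_le_right _ _))
    fun t => ?_
  -- the real identity: (2.6) on the coarse scale, `𝒯₄ g′ = g`, (1.1) and §4 on the fine scale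
  show H ((u0 U : ℂ) * Complex.cos (t : ℂ) + (u3 U : ℂ) * Complex.sin (t : ℂ)) =
    ((∫ V₁, H' ((u0 (U * V₁⁻¹) : ℂ) * Complex.cos ((t : ℂ) / 4) + (u3 (U * V₁⁻¹) : ℂ) * Complex.sin ((t : ℂ) / 4)) *
        ∫ V₂, H' ((u0 (V₁ * V₂⁻¹) : ℂ) * Complex.cos ((t : ℂ) / 4) + (u3 (V₁ * V₂⁻¹) : ℂ) * Complex.sin ((t : ℂ) / 4)) *
          ∫ V₃, H' ((u0 (V₂ * V₃⁻¹) : ℂ) * Complex.cos ((t : ℂ) / 4) + (u3 (V₂ * V₃⁻¹) : ℂ) * Complex.sin ((t : ℂ) / 4)) *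
            H' ((u0 V₃ : ℂ) * Complex.cos ((t : ℂ) / 4) + (u3 V₃ : ℂ) * Complex.sin ((t : ℂ) / 4))
          ∂(haarProbability (Matrix.specialUnitaryGroup (Fin 2) ℂ))
          ∂(haarProbability (Matrix.specialUnitaryGroup (Fin 2) ℂ))
        ∂(haarProbability (Matrix.specialUnitaryGroup (Fin 2) ℂ))) /
        ((convPow g' 3 1 : ℝ) : ℂ)) ^ 4
  rw [eq621_real_slice hg U t, ← hT, migdal_four, brace38_real_slice hg' hc' U t]
  push_cast
  rfl

/-- Hence (when `d ≤ 4d′`, the paper's regime) `g̃^{(−n)}(u, ·)` CONTINUES analytically from `{|Im z| < d}` to the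
wider strip `{|Im z| < 4d′}` — «|Im z| < r·(κ/2)(β^{(−n−1)})^{−α}» with `r = 4`. [cite: MullerSchiemann1987, Thm 3
proof p.283 L.40–43, (3.8) p.267] -/
theorem widening_step4_exists {d d' : ℝ} (hd : 0 < d) (hd' : 0 < d') (hdd : d ≤ 4 * d') {H H' : ℂ → ℂ}
    {g g' : (Matrix.specialUnitaryGroup (Fin 2) ℂ) → ℝ}
    (hH : DifferentiableOn ℂ H {w : ℂ | w.re ^ 2 / Real.cosh d ^ 2 + w.im ^ 2 / Real.sinh d ^ 2 < 1})
    (hH' : DifferentiableOn ℂ H' {w : ℂ | w.re ^ 2 / Real.cosh d' ^ 2 + w.im ^ 2 / Real.sinh d' ^ 2 < 1})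
    (hg : ∀ U, (g U : ℂ) = H (u0 U)) (hg' : ∀ U, (g' U : ℂ) = H' (u0 U)) (hc' : IsCentral g')
    (hT : migdal 4 g' = g) (U : (Matrix.specialUnitaryGroup (Fin 2) ℂ)) :
    ∃ F : ℂ → ℂ, DifferentiableOn ℂ F {z : ℂ | |z.im| < 4 * d'} ∧
      EqOn F (fun z : ℂ => H ((u0 U : ℂ) * Complex.cos z + (u3 U : ℂ) * Complex.sin z)) {z : ℂ | |z.im| < d} := by
  haveI : FirstCountableTopology (Matrix (Fin 2) (Fin 2) ℂ) :=
    inferInstanceAs (FirstCountableTopology (Fin 2 → Fin 2 → ℂ))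
  haveI : FirstCountableTopology (Matrix.specialUnitaryGroup (Fin 2) ℂ) :=
    Topology.IsInducing.subtypeVal.firstCountableTopology
  have hcont : ContinuousOn (uncurry fun (W : (Matrix.specialUnitaryGroup (Fin 2) ℂ)) (w : ℂ) =>
      H' ((u0 W : ℂ) * Complex.cos w + (u3 W : ℂ) * Complex.sin w)) (univ ×ˢ {z : ℂ | |z.im| < d'}) := by
    have := continuousOn_eq621 hH'.continuousOn
    rw [show (univ ×ˢ {z : ℂ | |z.im| < d'} : Set ((Matrix.specialUnitaryGroup (Fin 2) ℂ) × ℂ)) =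
      {p | |p.2.im| < d'} by ext p; simp]
    exact this
  refine ⟨_, differentiableOn_eq38 hcont (fun W => differentiableOn_eq621 hH' W) ((convPow g' 3 1 : ℝ) : ℂ) U,
    fun z hz => ?_⟩
  have hz' : z ∈ {z : ℂ | |z.im| < min d (4 * d')} := by
    show |z.im| < min d (4 * d'); rw [min_eq_left hdd]; exact hz
  exact ((widening_step4 hd hd' hH hH' hg hg' hc' hT U) hz').symm

/-! ## §6 «Iterating this argument …» — the widening tower with a general ratio `ρ` (p.283 L.40–45 with `r = ρ`)

The sibling `Theorem3Extensions.entire_of_tower` is the case `ρ = 2`; the gauge model needs `ρ = r = 4`. Scale-indexed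
families `A n : X → ℂ → ℂ` holomorphic (and jointly continuous) on strips of half-width `d_n`, scale-indexed transforms
`T n` that MULTIPLY the strip of holomorphy by `ρ` ((3.8): `T n B (x, z)` only involves `B(·, z/ρ)`), and the one-step
identity `T n (A (n+1)) = A n` on the strip of `A n`. Then every `A n (x, ·)` is the restriction of an ENTIRE function,
provided `ρ^m d_{n+m} → ∞` («with r^m (β^{(−n−m)})^{−α} → ∞») and `d_n ≤ ρ d_{n+1}`. -/

section Tower

variable {X : Type*} [TopologicalSpace X]

/-- **The widening tower with ratio `ρ`** (abstract form of p.283 L.40–45 for general `r`): see the section docstring.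
The `m`-th continuation of `A n` is `Ψ m n := T n (T (n+1) (⋯ (A (n+m))))`, holomorphic on `{|Im z| < ρ^m d_{n+m}}` and
equal to `A n` on `{|Im z| < d_n}`; the continuations are glued along the exhausting strips by the identity theorem.
[cite: MullerSchiemann1987, Thm 3 proof p.283 L.40–45] -/
theorem entire_of_tower_ratio (ρ : ℝ) (A : ℕ → X → ℂ → ℂ) (T : ℕ → (X → ℂ → ℂ) → X → ℂ → ℂ) (d : ℕ → ℝ)
    (hd : ∀ n, 0 < d n) (hdρ : ∀ n, d n ≤ ρ * d (n + 1))
    (hdiv : ∀ n, Tendsto (fun m : ℕ => ρ ^ m * d (n + m)) atTop atTop)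
    (P1 : ∀ (n : ℕ) (e : ℝ) (B : X → ℂ → ℂ), ContinuousOn (uncurry B) (univ ×ˢ {z : ℂ | |z.im| < e}) →
      (∀ x, DifferentiableOn ℂ (B x) {z : ℂ | |z.im| < e}) →
      ContinuousOn (uncurry (T n B)) (univ ×ˢ {z : ℂ | |z.im| < ρ * e}) ∧
        ∀ x, DifferentiableOn ℂ (T n B x) {z : ℂ | |z.im| < ρ * e})
    (P2 : ∀ (n : ℕ) (e : ℝ) (B B' : X → ℂ → ℂ), (∀ x, EqOn (B x) (B' x) {z : ℂ | |z.im| < e}) →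
      ∀ x, EqOn (T n B x) (T n B' x) {z : ℂ | |z.im| < ρ * e})
    (P3 : ∀ n x, EqOn (T n (A (n + 1)) x) (A n x) {z : ℂ | |z.im| < d n})
    (P4 : ∀ n, ContinuousOn (uncurry (A n)) (univ ×ˢ {z : ℂ | |z.im| < d n}) ∧
      ∀ x, DifferentiableOn ℂ (A n x) {z : ℂ | |z.im| < d n})
    (n : ℕ) (x : X) : ∃ F : ℂ → ℂ, Differentiable ℂ F ∧ EqOn F (A n x) {z : ℂ | |z.im| < d n} := by
  classical
  -- the ratio is positive (`0 < d 0 ≤ ρ d 1`, `0 < d 1`)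
  have hρ : 0 < ρ := by
    by_contra h
    push Not at h
    have h1 : ρ * d 1 ≤ 0 := mul_nonpos_of_nonpos_of_nonneg h (hd 1).le
    linarith [hd 0, hdρ 0]
  -- the continuations `Ψ m n = T n (Ψ m (n+1))`, `Ψ 0 = A`
  let Ψ : ℕ → ℕ → X → ℂ → ℂ := fun m =>
    Nat.rec (motive := fun _ => ℕ → X → ℂ → ℂ) A (fun _ Ψm k => T k (Ψm (k + 1))) m
  have Ψ_zero : Ψ 0 = A := rfl
  have Ψ_succ : ∀ m k, Ψ (m + 1) k = T k (Ψ m (k + 1)) := fun m k => rfl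
  -- the strip half-widths `c m k = ρ^m d_{k+m}`
  let c : ℕ → ℕ → ℝ := fun m k => ρ ^ m * d (k + m)
  have c_zero : ∀ k, c 0 k = d k := fun k => by simp [c]
  have c_succ : ∀ m k, c (m + 1) k = ρ * c m (k + 1) := fun m k => by
    simp only [c]; rw [pow_succ, show k + (m + 1) = k + 1 + m by omega]; ring
  -- (1) holomorphy and joint continuity of the continuations
  have h1 : ∀ m k, ContinuousOn (uncurry (Ψ m k)) (univ ×ˢ {z : ℂ | |z.im| < c m k}) ∧
      ∀ y, DifferentiableOn ℂ (Ψ m k y) {z : ℂ | |z.im| < c m k} := by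
    intro m
    induction m with
    | zero => intro k; rw [Ψ_zero, c_zero]; exact P4 k
    | succ m ih =>
        intro k
        rw [Ψ_succ, c_succ]
        exact P1 k (c m (k + 1)) (Ψ m (k + 1)) (ih (k + 1)).1 (ih (k + 1)).2
  -- (2) the continuations agree with `A k` on the original strip
  have h2 : ∀ m k y, EqOn (Ψ m k y) (A k y) {z : ℂ | |z.im| < d k} := by
    intro m
    induction m with
    | zero => intro k y z _; rw [Ψ_zero]
    | succ m ih =>
        intro k y
        rw [Ψ_succ]
        have hsub : {z : ℂ | |z.im| < d k} ⊆ {z : ℂ | |z.im| < ρ * d (k + 1)} :=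
          fun z hz => lt_of_lt_of_le hz (hdρ k)
        exact ((P2 k (d (k + 1)) (Ψ m (k + 1)) (A (k + 1)) (ih (k + 1)) y).mono hsub).trans (P3 k y)
  -- (3) the strips exhaust: `d n ≤ c m n`
  have h3 : ∀ m k, d k ≤ c m k := by
    intro m
    induction m with
    | zero => intro k; rw [c_zero]
    | succ m ih =>
        intro k
        rw [c_succ]
        have := mul_le_mul_of_nonneg_left (ih (k + 1)) hρ.le
        linarith [hdρ k]
  -- (4) two continuations agree on the smaller of their strips (identity theorem from the real axis)
  have h4 : ∀ m m', EqOn (Ψ m n x) (Ψ m' n x) {z : ℂ | |z.im| < min (c m n) (c m' n)} := by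
    intro m m'
    refine eqOn_setOf_abs_im_lt_of_forall_ofReal
      (lt_min (lt_of_lt_of_le (hd n) (h3 m n)) (lt_of_lt_of_le (hd n) (h3 m' n)))
      (((h1 m n).2 x).mono fun z (hz : |z.im| < min (c m n) (c m' n)) =>
        show |z.im| < c m n from lt_of_lt_of_le hz (min_le_left _ _))
      (((h1 m' n).2 x).mono fun z (hz : |z.im| < min (c m n) (c m' n)) =>
        show |z.im| < c m' n from lt_of_lt_of_le hz (min_le_right _ _)) fun t => ?_
    have ht : ((t : ℂ)) ∈ {z : ℂ | |z.im| < d n} := by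
      show |(t : ℂ).im| < d n; rw [Complex.ofReal_im, abs_zero]; exact hd n
    rw [h2 m n x ht, h2 m' n x ht]
  -- (5) glue
  have hex : ∀ z : ℂ, ∃ m, |z.im| < c m n := fun z =>
    (((hdiv n).eventually (eventually_gt_atTop |z.im|))).exists
  choose mz hmz using hex
  refine ⟨fun z => Ψ (mz z) n x z, ?_, ?_⟩
  · refine differentiable_of_strips (c := fun m => c m n) (hdiv n) fun m => ?_
    refine ((h1 m n).2 x).congr fun z hz => ?_
    exact h4 (mz z) m (lt_min (hmz z) hz)
  · intro z hz
    have hz0 : |z.im| < c 0 n := by rw [c_zero]; exact hz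
    show Ψ (mz z) n x z = A n x z
    rw [h4 (mz z) 0 (lt_min (hmz z) hz0), Ψ_zero]

end Tower

/-! ## §7 «… shows that g̃^{(−n)}(u, z) is entire in z ∈ ℂ for all n. □» for `r = 4` — the tower on `SU(2)` and
THEOREM 3 with (A₁)'s entire-ness of the extensions -/

/-- **Entire-ness of the limit extensions, `r = 4`** (p.283 L.40–45 on `SU(2)` with (3.8)): if at every scale `n` the
Gibbs factor is `g^{(−n)} = H^{(−n)}(u₀)` with `H^{(−n)}` holomorphic on the ellipse `𝒟(d_n)`, `g^{(−n)}` a class function,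
and `𝒯₄ g^{(−n−1)} = g^{(−n)}`, and if the strip half-widths satisfy `d_n ≤ 4d_{n+1}` and `4^m d_{n+m} → ∞`, then for
every `n` and `u` the extension `z ↦ g̃^{(−n)}(u, z) = H^{(−n)}(u₀ cos z + u₃ sin z)` is the restriction to `{|Im z| < d_n}`
of an ENTIRE function. [cite: MullerSchiemann1987, Thm 3 proof p.283 L.40–45, (3.8) p.267, (A₁) p.266] -/
theorem entire_of_limits4 (d : ℕ → ℝ) (hd : ∀ n, 0 < d n) (hd4 : ∀ n, d n ≤ 4 * d (n + 1))
    (hdiv : ∀ n, Tendsto (fun m : ℕ => (4 : ℝ) ^ m * d (n + m)) atTop atTop)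
    {Hl : ℕ → ℂ → ℂ} {gl : ℕ → (Matrix.specialUnitaryGroup (Fin 2) ℂ) → ℝ}
    (hH : ∀ n, DifferentiableOn ℂ (Hl n)
      {w : ℂ | w.re ^ 2 / Real.cosh (d n) ^ 2 + w.im ^ 2 / Real.sinh (d n) ^ 2 < 1})
    (hgH : ∀ n U, (gl n U : ℂ) = Hl n (u0 U)) (hc : ∀ n, IsCentral (gl n))
    (hT : ∀ n, migdal 4 (gl (n + 1)) = gl n) (n : ℕ) (U : (Matrix.specialUnitaryGroup (Fin 2) ℂ)) :
    ∃ F : ℂ → ℂ, Differentiable ℂ F ∧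
      EqOn F (fun z : ℂ => Hl n ((u0 U : ℂ) * Complex.cos z + (u3 U : ℂ) * Complex.sin z))
        {z : ℂ | |z.im| < d n} := by
  -- `SU(2) ⊆ M₂(ℂ)` is first countable (needed for the dominated-convergence continuity of (3.8))
  haveI : FirstCountableTopology (Matrix (Fin 2) (Fin 2) ℂ) :=
    inferInstanceAs (FirstCountableTopology (Fin 2 → Fin 2 → ℂ))
  haveI : FirstCountableTopology (Matrix.specialUnitaryGroup (Fin 2) ℂ) :=
    Topology.IsInducing.subtypeVal.firstCountableTopology
  -- joint continuity of the extensions in §3's format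
  have hcont : ∀ k, ContinuousOn (uncurry fun (W : (Matrix.specialUnitaryGroup (Fin 2) ℂ)) (w : ℂ) =>
      Hl k ((u0 W : ℂ) * Complex.cos w + (u3 W : ℂ) * Complex.sin w)) (univ ×ˢ {z : ℂ | |z.im| < d k}) := by
    intro k
    have := continuousOn_eq621 (hH k).continuousOn
    rw [show (univ ×ˢ {z : ℂ | |z.im| < d k} : Set ((Matrix.specialUnitaryGroup (Fin 2) ℂ) × ℂ)) =
      {p | |p.2.im| < d k} by ext p; simp]
    exact this
  refine entire_of_tower_ratio 4
    (fun k (W : (Matrix.specialUnitaryGroup (Fin 2) ℂ)) (w : ℂ) =>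
      Hl k ((u0 W : ℂ) * Complex.cos w + (u3 W : ℂ) * Complex.sin w))
    (fun k (B : (Matrix.specialUnitaryGroup (Fin 2) ℂ) → ℂ → ℂ) (W : (Matrix.specialUnitaryGroup (Fin 2) ℂ)) (w : ℂ) =>
      ((∫ V₁, B (W * V₁⁻¹) (w / 4) * ∫ V₂, B (V₁ * V₂⁻¹) (w / 4) * ∫ V₃, B (V₂ * V₃⁻¹) (w / 4) * B V₃ (w / 4)
          ∂(haarProbability (Matrix.specialUnitaryGroup (Fin 2) ℂ))
          ∂(haarProbability (Matrix.specialUnitaryGroup (Fin 2) ℂ))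
        ∂(haarProbability (Matrix.specialUnitaryGroup (Fin 2) ℂ))) /
        ((convPow (gl (k + 1)) 3 1 : ℝ) : ℂ)) ^ 4)
    d hd hd4 hdiv ?_ ?_ ?_ ?_ n U
  · -- (P1) the continued (3.8) multiplies the strip of holomorphy by 4 (§3)
    intro k e B hBc hBh
    exact ⟨continuousOn_eq38 hBc _, fun W => differentiableOn_eq38 hBc hBh _ W⟩
  · -- (P2) the continued (3.8) at `(·, w)` only involves `B(·, w/4)`
    intro k e B B' hBB' W w hw
    have hw' : |(w / 4).im| < e := abs_im_quarter_lt hw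
    have key : ∀ V : (Matrix.specialUnitaryGroup (Fin 2) ℂ), B V (w / 4) = B' V (w / 4) := fun V => hBB' V hw'
    show ((∫ V₁, B (W * V₁⁻¹) (w / 4) * ∫ V₂, B (V₁ * V₂⁻¹) (w / 4) * ∫ V₃, B (V₂ * V₃⁻¹) (w / 4) * B V₃ (w / 4)
          ∂(haarProbability (Matrix.specialUnitaryGroup (Fin 2) ℂ))
          ∂(haarProbability (Matrix.specialUnitaryGroup (Fin 2) ℂ))
        ∂(haarProbability (Matrix.specialUnitaryGroup (Fin 2) ℂ))) /
        ((convPow (gl (k + 1)) 3 1 : ℝ) : ℂ)) ^ 4 =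
      ((∫ V₁, B' (W * V₁⁻¹) (w / 4) * ∫ V₂, B' (V₁ * V₂⁻¹) (w / 4) * ∫ V₃, B' (V₂ * V₃⁻¹) (w / 4) * B' V₃ (w / 4)
          ∂(haarProbability (Matrix.specialUnitaryGroup (Fin 2) ℂ))
          ∂(haarProbability (Matrix.specialUnitaryGroup (Fin 2) ℂ))
        ∂(haarProbability (Matrix.specialUnitaryGroup (Fin 2) ℂ))) /
        ((convPow (gl (k + 1)) 3 1 : ℝ) : ℂ)) ^ 4
    simp only [key]
  · -- (P3) the one-step widening identity of §5 on the strip of `A k` (`min d_k (4 d_{k+1}) = d_k`)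
    intro k W w hw
    have h := widening_step4 (hd k) (hd (k + 1)) (hH k) (hH (k + 1)) (hgH k) (hgH (k + 1)) (hc (k + 1)) (hT k) W
    have hw' : w ∈ {z : ℂ | |z.im| < min (d k) (4 * d (k + 1))} := by
      show |w.im| < min (d k) (4 * d (k + 1)); rw [min_eq_left (hd4 k)]; exact hw
    exact (h hw').symm
  · -- (P4) the extensions (6.21) are jointly continuous and holomorphic in `z` on their strips
    intro k
    exact ⟨hcont k, fun W => differentiableOn_eq621 (hH k) W⟩

/-- **THEOREM 3 on `SU(2)`, `r = 4` (the gauge model's (3.8)), with (A₁)'s «entire holomorphic in z»** for the limit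
extensions: under the hypotheses of the sibling `theorem3_SU2` with `𝒯 = 𝒯₄` and the growth of the strips
(`d_n ≤ 4d_{n+1}`, `4^m d_{n+m} → ∞`: the paper's «r^m (β^{(−n−m)})^{−α} → ∞» with `r = 4`), there are one strictly
increasing `N_j` and, at every scale `n`, limits `h^{(−n)}` ((6.19) locally uniformly, holomorphic on `{|Im z| < d_n}`),
`g^{(−n)} ∈ 𝒢` ((6.22) uniformly, `𝒯₄ g^{(−n−1)} = g^{(−n)}`), `H^{(−n)}` holomorphic on `𝒟(d_n)` with (6.20)
`h^{(−n)} = H^{(−n)} ∘ cos` on the strip and `g^{(−n)} = H^{(−n)}(u₀)`, AND the extensions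
`g̃^{(−n)}(u, ·) = H^{(−n)}(u₀ cos · + u₃ sin ·)` are restrictions of ENTIRE functions. This is the last paragraph of the
proof of Theorem 3, case (3.8), applied to the limits it constructs. [cite: MullerSchiemann1987, Thm 3 p.282
(«satisfying (A₁)»), proof p.283 L.40–45, (3.8) p.267] -/
theorem theorem3_SU2_entire4 {d M : ℕ → ℝ} (hd : ∀ n, 0 < d n) (hd4 : ∀ n, d n ≤ 4 * d (n + 1))
    (hdiv : ∀ n, Tendsto (fun m : ℕ => (4 : ℝ) ^ m * d (n + m)) atTop atTop)
    {h : ℕ → ℕ → ℂ → ℂ} {g : ℕ → ℕ → (Matrix.specialUnitaryGroup (Fin 2) ℂ) → ℝ}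
    (hhol : ∀ N n, n ≤ N → DifferentiableOn ℂ (h N n) {z : ℂ | |z.im| < d n})
    (hbd : ∀ N n, n ≤ N → ∀ z : ℂ, |z.im| < d n → ‖h N n z‖ ≤ M n)
    (hper : ∀ N n, n ≤ N → Function.Periodic (h N n) (2 * π))
    (heven : ∀ N n, n ≤ N → ∀ z, h N n (-z) = h N n z)
    (hgh : ∀ N n, n ≤ N → ∀ U, (g N n U : ℂ) = h N n (Real.arccos (u0 U)))
    (hG : ∀ N n, n ≤ N → InG (g N n))
    (hrec : ∀ N n, n + 1 ≤ N → migdal 4 (g N (n + 1)) = g N n) :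
    ∃ Nj : ℕ → ℕ, StrictMono Nj ∧ ∃ hlim : ℕ → ℂ → ℂ,
      ∃ glim : ℕ → (Matrix.specialUnitaryGroup (Fin 2) ℂ) → ℝ, ∃ Hlim : ℕ → ℂ → ℂ,
      (∀ n, DifferentiableOn ℂ (hlim n) {z : ℂ | |z.im| < d n} ∧
        TendstoLocallyUniformlyOn (fun j => h (Nj j) n) (hlim n) atTop {z : ℂ | |z.im| < d n} ∧
        TendstoUniformly (fun j => g (Nj j) n) (glim n) atTop ∧
        InG (glim n) ∧ migdal 4 (glim (n + 1)) = glim n ∧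
        DifferentiableOn ℂ (Hlim n)
          {w : ℂ | w.re ^ 2 / Real.cosh (d n) ^ 2 + w.im ^ 2 / Real.sinh (d n) ^ 2 < 1} ∧
        (∀ z : ℂ, |z.im| < d n → hlim n z = Hlim n (Complex.cos z)) ∧
        (∀ U : (Matrix.specialUnitaryGroup (Fin 2) ℂ), ((glim n U : ℝ) : ℂ) = Hlim n (u0 U))) ∧
      ∀ n (U : (Matrix.specialUnitaryGroup (Fin 2) ℂ)), ∃ F : ℂ → ℂ, Differentiable ℂ F ∧
        EqOn F (fun z : ℂ => Hlim n ((u0 U : ℂ) * Complex.cos z + (u3 U : ℂ) * Complex.sin z))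
          {z : ℂ | |z.im| < d n} := by
  obtain ⟨Nj, hNj, hlim, glim, Hlim, hall⟩ := theorem3_SU2 4 hd hhol hbd hper heven hgh hG hrec
  refine ⟨Nj, hNj, hlim, glim, Hlim, fun n => ⟨(hall n).1, (hall n).2.1, (hall n).2.2.1, (hall n).2.2.2.1,
    (hall n).2.2.2.2.1, (hall n).2.2.2.2.2.1, (hall n).2.2.2.2.2.2.1, (hall n).2.2.2.2.2.2.2.2.2.2.2⟩, ?_⟩
  exact entire_of_limits4 d hd hd4 hdiv (fun n => (hall n).2.2.2.2.2.1) (fun n => (hall n).2.2.2.2.2.2.2.2.2.2.2)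
    (fun n => (hall n).2.2.2.1.central) (fun n => (hall n).2.2.2.2.1)

end Theorem3ExtensionsR4

end MullerSchiemann1987

end Literature.MathematicalPhysics.QuantumFieldTheory
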